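import Summits.ResolutionOfSingularities.ResolutionOfSingularities.Theorems.HilbertSamuelEliminationCampaignW42FibreConePresentation
import Literature.RingTheory.HilbertSamuel.TangentConeChangeOfGenerators
import HarnessLib

/-!
# [OURS · L1 W4.2] The tangent cone ideal in an ARBITRARY generating family of `𝔫`: it is the fibre cone ideal
# `I(x)` of `…FibreConePresentation`, and two families `x' = b·x` give `J_{x'} = Θ_b̄⁻¹(J_x)` for the (rectangular) linear
# substitution `Θ_b̄ : Z_l ↦ Σ_i b̄_{li} X_i` (campaign s42, cell res-hironaka; informal crux `RidgeConfinement`,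
# stmt-ResolutionOfSingularities-17845; `--supports`)

HONEST FRAMING. OURS (slot W4.2, prover res-L1-s42-pv-1, gen 3). The tree's tangent cone ideal
`tangentConeIdeal x hx ⊆ k[X_1, …, X_e]` (`TangentConeIdeal.lean`: spanned by the forms `F̄` of degree `d` with
`F(x) ∈ 𝔫^{d+1}`) is defined for ANY family `x` generating the maximal ideal `𝔫` of a local ring `(A, 𝔫, k)`, and the
tree's change-of-generators (`TangentConeChangeOfGenerators.lean`) is for two families of the SAME length. The route's
ridge `localRidge A` is read in the minimal family `minGenerators A`; the fibre-cone confinement of this campaign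
(`…PermissibleRidgeFibreCone.lean`) is read in the family `(c, y)` adapted to the centre. This file supplies:

* `fibreConeIdeal_eq_tangentConeIdeal` — **`I(x) = J_x`**: the fibre cone ideal of `𝔫` presented by `x`
  (`CampaignW42.fibreConeIdeal x`, the kernel of `k[X] ↠ gr_𝔫(A) = FibreCone 𝔫`) IS the tangent cone ideal;
  hence `hilbertFunQuot k e (fibreConeIdeal x) = H⁽⁰⁾(A)`;
* `CampaignW42.rectSubst b : R[Z_1, …, Z_{e'}] → R[X_1, …, X_e]`, `Z_l ↦ Σ_i b_{li} X_i` (any commutative `R`, any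
  `e' × e` matrix) with `rectSubst_X`, `isHomogeneous_rectSubst`, `map_rectSubst`, `eval_rectSubst`,
  `homogeneousComponent_rectSubst`;
* `tangentConeIdeal_le_ker_constantCoeff` (for any generating family);
* **`tangentConeIdeal_eq_comap_rectSubst`** — for generating families `x` (length `e`) and `x'` (length `e'`) with
  `x'_l = Σ_i b_{li} x_i`: `J_{x'} = (J_x).comap (rectSubst b̄)` — a form `g(Z)` lies in `J_{x'}` iff `g(b̄X) ∈ J_x`.

NOTHING here is a statement of H. Hironaka's manuscript [Hironaka2017]. AI review is weaker than expert review.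
References (orientation only): V. Cossart, U. Jannsen, S. Saito, LNM 2270 (2020), §2.2, Def. 2.18.
-/

noncomputable section

-- single-conjunct summit: the doubled namespace component `ResolutionOfSingularities` is mandated
set_option linter.dupNamespace false

open IsLocalRing MvPolynomial
open Literature.RingTheory.HilbertSamuel
open Literature.AlgebraicGeometry.Resolution

namespace Summit.ResolutionOfSingularities.ResolutionOfSingularities.Theorems

namespace CampaignW42

universe u

/-! ## `I(x) = J_x` -/

section FibreConeTangentCone

variable {A : Type u} [CommRing A] [IsLocalRing A] {e : ℕ} (x : Fin e → A)
  (hx : Ideal.span (Set.range x) = maximalIdeal A)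

include hx in
/-- `𝔫 · 𝔫ᵈ = 𝔫^{d+1}` read through `span x = 𝔫`. [folklore] -/
theorem maximalIdeal_mul_span_pow (d : ℕ) :
    maximalIdeal A * Ideal.span (Set.range x) ^ d = maximalIdeal A ^ (d + 1) := by
  rw [hx, pow_succ']

/-- **The fibre cone ideal of `𝔫` in the generators `x` is the tangent cone ideal `J_x`.**
[cite: CossartJannsenSaito2020, §2.2 (p. 27)] -/
theorem fibreConeIdeal_eq_tangentConeIdeal : fibreConeIdeal x = tangentConeIdeal x hx := by
  classical
  apply le_antisymm
  · intro g hg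
    rw [← sum_homogeneousComponent g]
    refine Ideal.sum_mem _ fun d _ => ?_
    have hgd := isHomogeneousIdeal_fibreConeIdeal x g hg d
    obtain ⟨G, hG, hGg⟩ := exists_isHomogeneous_map_residue_eq (homogeneousComponent_isHomogeneous d g)
    rw [← hGg] at hgd ⊢
    have hev := (map_residue_mem_fibreConeIdeal_iff x hG).mp hgd
    rw [maximalIdeal_mul_span_pow x hx] at hev
    exact mem_tangentConeIdeal_of_mem_symbolForms x hx d
      ((mem_symbolForms_iff_exists_form x hx).mpr ⟨G, hG, hev, rfl⟩)
  · rw [tangentConeIdeal, Ideal.span_le]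
    intro f hf
    obtain ⟨d, hd⟩ := Set.mem_iUnion.mp hf
    obtain ⟨F, hF, hFx, rfl⟩ := (mem_symbolForms_iff_exists_form x hx).mp hd
    refine (map_residue_mem_fibreConeIdeal_iff x hF).mpr ?_
    rwa [maximalIdeal_mul_span_pow x hx]

include hx in
/-- Hence **`H(k[X]/I(x)) = H⁽⁰⁾(A)`** for every generating family `x` of `𝔫`. [cite: CossartJannsenSaito2020, §2.2 (p. 27)] -/
theorem hilbertFunQuot_fibreConeIdeal_eq_hilbertFun [IsNoetherianRing A] :
    hilbertFunQuot (ResidueField A) e (fibreConeIdeal x) = hilbertFun A := by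
  rw [fibreConeIdeal_eq_tangentConeIdeal x hx, hilbertFunQuot_tangentConeIdeal]

include hx in
/-- `J_x` has no constant terms. [folklore] -/
theorem tangentConeIdeal_le_ker_constantCoeff :
    tangentConeIdeal x hx ≤ RingHom.ker (constantCoeff : MvPolynomial (Fin e) (ResidueField A) →+* ResidueField A) := by
  rw [← fibreConeIdeal_eq_tangentConeIdeal x hx]
  intro g hg
  have h := fibreConeIdeal_le_ker_eval_zero x hg
  rw [RingHom.mem_ker] at h ⊢
  rwa [← eval_zero]

end FibreConeTangentCone

/-! ## Rectangular linear substitutions -/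

section RectSubst

variable {R : Type u} [CommRing R] {e e' : ℕ}

/-- [OURS · L1 W4.2] **The linear substitution `Z_l ↦ Σ_i b_{li} X_i`**, `R[Z_1, …, Z_{e'}] → R[X_1, …, X_e]`, of an
`e' × e` matrix `b` (bookkeeping; the square case is the tree's `linSubst`). NOT a statement of the manuscript. [folklore] -/
def rectSubst (b : Matrix (Fin e') (Fin e) R) : MvPolynomial (Fin e') R →ₐ[R] MvPolynomial (Fin e) R :=
  bind₁ fun l => ∑ i, C (b l i) * X i

/-- `rectSubst b (Z_l) = Σ_i b_{li} X_i`. [folklore] -/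
@[simp] theorem rectSubst_X (b : Matrix (Fin e') (Fin e) R) (l : Fin e') :
    rectSubst b (X l) = ∑ i, C (b l i) * X i :=
  bind₁_X_right _ l

/-- `rectSubst b (C r) = C r`. [folklore] -/
@[simp] theorem rectSubst_C (b : Matrix (Fin e') (Fin e) R) (r : R) : rectSubst b (C r) = C r :=
  bind₁_C_right _ r

/-- A linear substitution preserves forms of degree `d`. [folklore] -/
theorem isHomogeneous_rectSubst (b : Matrix (Fin e') (Fin e) R) {g : MvPolynomial (Fin e') R} {d : ℕ}
    (hg : g.IsHomogeneous d) : (rectSubst b g).IsHomogeneous d := by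
  have h := hg.aeval (fun l => ∑ i, C (b l i) * X i) (n := 1) fun l =>
    IsHomogeneous.sum _ _ _ fun i _ => isHomogeneous_C_mul_X (b l i) i
  rwa [aeval_eq_bind₁, one_mul] at h

/-- Linear substitutions commute with a change of coefficients. [folklore] -/
theorem map_rectSubst {S : Type u} [CommRing S] (f : R →+* S) (b : Matrix (Fin e') (Fin e) R)
    (g : MvPolynomial (Fin e') R) :
    MvPolynomial.map f (rectSubst b g) = rectSubst (b.map f) (MvPolynomial.map f g) := by
  rw [rectSubst, rectSubst, map_bind₁]
  have hfun : (fun l : Fin e' => MvPolynomial.map f (∑ i, C (b l i) * X i)) =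
      fun l => ∑ i, C (b.map f l i) * X i :=
    _root_.funext fun l => by simp [_root_.map_sum, Matrix.map_apply]
  rw [hfun]

/-- **Evaluation**: `(rectSubst b G)(x) = G(x')` when `x'_l = Σ_i b_{li} x_i`. [folklore] -/
theorem eval_rectSubst (b : Matrix (Fin e') (Fin e) R) {x : Fin e → R} {x' : Fin e' → R}
    (hb : ∀ l, x' l = ∑ i, b l i * x i) (G : MvPolynomial (Fin e') R) :
    eval x (rectSubst b G) = eval x' G := by
  change eval₂Hom (RingHom.id R) x (bind₁ _ G) = eval₂Hom (RingHom.id R) x' G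
  rw [eval₂Hom_bind₁]
  have hfun : (fun l : Fin e' => eval₂Hom (RingHom.id R) x (∑ i, C (b l i) * X i)) = x' :=
    _root_.funext fun l => by
      change eval x (∑ i, C (b l i) * X i) = x' l
      rw [hb l]
      simp [_root_.map_sum]
  rw [hfun]

/-- Linear substitutions commute with taking homogeneous components. [folklore] -/
theorem homogeneousComponent_rectSubst (b : Matrix (Fin e') (Fin e) R) (g : MvPolynomial (Fin e') R) (d : ℕ) :
    homogeneousComponent d (rectSubst b g) = rectSubst b (homogeneousComponent d g) := by
  classical
  conv_lhs => rw [← sum_homogeneousComponent g, map_sum, map_sum]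
  rw [Finset.sum_eq_single d]
  · exact homogeneousComponent_eq_self (isHomogeneous_rectSubst b (homogeneousComponent_isHomogeneous d g))
  · intro j _ hjd
    rw [homogeneousComponent_of_mem (isHomogeneous_rectSubst b (homogeneousComponent_isHomogeneous j g)), if_neg (Ne.symm hjd)]
  · intro hd
    have hlt : g.totalDegree < d := by simpa using hd
    rw [homogeneousComponent_eq_zero _ _ hlt, map_zero, map_zero]

end RectSubst

/-! ## `J_{x'} = Θ_b̄⁻¹(J_x)` -/

section ChangeOfGenerators

variable {A : Type u} [CommRing A] [IsLocalRing A] {e e' : ℕ} {x : Fin e → A} {x' : Fin e' → A}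
  (hx : Ideal.span (Set.range x) = maximalIdeal A) (hx' : Ideal.span (Set.range x') = maximalIdeal A)
  {b : Matrix (Fin e') (Fin e) A} (hb : ∀ l, x' l = ∑ i, b l i * x i)

/-- A form of degree `d` with coefficients in `𝔫` evaluates at `x` into `𝔫^{d+1}`. [folklore] -/
theorem eval_mem_pow_succ_of_coeff_mem (hx : Ideal.span (Set.range x) = maximalIdeal A)
    {H : MvPolynomial (Fin e) A} {d : ℕ} (hH : H.IsHomogeneous d)
    (hcoeff : ∀ m, H.coeff m ∈ maximalIdeal A) : eval x H ∈ maximalIdeal A ^ (d + 1) := by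
  classical
  rw [H.as_sum, map_sum]
  refine Ideal.sum_mem _ fun m hm => ?_
  have hmono : (monomial m (1 : A)).IsHomogeneous d := by
    have h := hH (mem_support_iff.mp hm)
    refine isHomogeneous_monomial _ ?_
    rw [Finsupp.degree_eq_weight_one]
    exact h
  have h1 : eval x (monomial m (1 : A)) ∈ Ideal.span (Set.range x) ^ d := eval_mem_pow_of_isHomogeneous x hmono
  rw [hx] at h1
  have h2 : monomial m (H.coeff m) = C (H.coeff m) * monomial m 1 := by rw [C_mul_monomial, mul_one]
  rw [h2, map_mul, eval_C, pow_succ']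
  exact Ideal.mul_mem_mul (hcoeff m) h1

include hx hx' hb in
/-- **Forms: `ḡ ∈ W_d(x') ⟺ ḡ(b̄X) ∈ W_d(x)`.** [cite: CossartJannsenSaito2020, §2.2 (p. 27)] -/
theorem mem_symbolForms_iff_rectSubst_mem {d : ℕ} {g : MvPolynomial (Fin e') (ResidueField A)}
    (hg : g.IsHomogeneous d) :
    g ∈ symbolForms x' hx' d ↔ rectSubst (b.map (residue A)) g ∈ symbolForms x hx d := by
  constructor
  · intro h
    obtain ⟨G, hG, hGx', rfl⟩ := (mem_symbolForms_iff_exists_form x' hx').mp h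
    refine (mem_symbolForms_iff_exists_form x hx).mpr ⟨rectSubst b G, isHomogeneous_rectSubst b hG, ?_, ?_⟩
    · rw [eval_rectSubst b hb]; exact hGx'
    · exact map_rectSubst (residue A) b G
  · intro h
    obtain ⟨F, hF, hFx, hFg⟩ := (mem_symbolForms_iff_exists_form x hx).mp h
    obtain ⟨G, hG, rfl⟩ := exists_isHomogeneous_map_residue_eq hg
    refine (mem_symbolForms_iff_exists_form x' hx').mpr ⟨G, hG, ?_, rfl⟩
    -- `G(x') = (rectSubst b G)(x) = F(x) + (rectSubst b G - F)(x)`, the difference having coefficients in `𝔫`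
    have hdiff : ∀ m, (rectSubst b G - F).coeff m ∈ maximalIdeal A := by
      intro m
      rw [← residue_eq_zero_iff, coeff_sub, map_sub, sub_eq_zero, ← coeff_map, ← coeff_map,
        map_rectSubst, hFg]
    have hev : eval x (rectSubst b G - F) ∈ maximalIdeal A ^ (d + 1) :=
      eval_mem_pow_succ_of_coeff_mem hx ((isHomogeneous_rectSubst b hG).sub hF) hdiff
    rw [← eval_rectSubst b hb, show rectSubst b G = (rectSubst b G - F) + F by ring, map_add]
    exact add_mem hev hFx

include hb in
/-- **`J_{x'} = Θ_b̄⁻¹(J_x)`**: the tangent cone ideal in the generators `x' = b·x` is the pull-back of the one in `x`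
along `Z_l ↦ Σ_i b̄_{li} X_i` (families of any lengths). [cite: CossartJannsenSaito2020, §2.2 (p. 27)] -/
theorem tangentConeIdeal_eq_comap_rectSubst :
    tangentConeIdeal x' hx' = (tangentConeIdeal x hx).comap (rectSubst (b.map (residue A))) := by
  classical
  ext g
  rw [Ideal.mem_comap]
  constructor
  · intro hg
    rw [← sum_homogeneousComponent g, map_sum]
    refine Ideal.sum_mem _ fun d _ => mem_tangentConeIdeal_of_mem_symbolForms x hx d ?_
    exact (mem_symbolForms_iff_rectSubst_mem hx hx' hb (homogeneousComponent_isHomogeneous d g)).mp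
      (homogeneousComponent_mem_symbolForms_of_mem x' hx' hg d)
  · intro hg
    rw [← sum_homogeneousComponent g]
    refine Ideal.sum_mem _ fun d _ => mem_tangentConeIdeal_of_mem_symbolForms x' hx' d ?_
    refine (mem_symbolForms_iff_rectSubst_mem hx hx' hb (homogeneousComponent_isHomogeneous d g)).mpr ?_
    rw [← homogeneousComponent_rectSubst]
    exact homogeneousComponent_mem_symbolForms_of_mem x hx hg d

end ChangeOfGenerators

end CampaignW42

end Summit.ResolutionOfSingularities.ResolutionOfSingularities.Theorems

end
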